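import Literature.Geometry.Lorentzian.RicciChartDecay
import Literature.Geometry.Lorentzian.RicciVariationScalarCurvature
import HarnessLib

/-!
# The Ricci variation of Schoen–Yau: step 2 of positive mass rigidity from the two elliptic steps

Step 2 of the proof of positive mass rigidity (Schoen–Yau, Comm. Math. Phys. 65 (1979), Thm. 2;
§3, pp. 72–74) is the named fact `exists_ricciVariation_negativeMass_of_massZero` of
`PositiveMassRigidity.lean`: for an oriented, one-ended, strongly asymptotically flat `3`-manifold
with mass parameter `0`, `R ≡ 0` and `Ric ≢ 0`, some `t₀ < 0` and some positive `φ` make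
`φ⁴ (h + t₀ Ric)` asymptotically Schwarzschildean of negative mass and scalar flat. This file
reduces that fact, by one proved theorem, to the two genuinely analytic steps of the printed
proof — the linear elliptic theory of Lemmas 3.1–3.3 on asymptotically flat `3`-manifolds:

* `hc` — **Lemma 3.3 applied to the family** `ds²_t = ds² + t Ric` (pp. 71–73): the conformal
  factors `φ_t > 0` with `φ_t⁴ ds²_t` scalar flat and asymptotically flat of mass
  `M(t) = -c₁ ∫ R_t φ_t dV_t` ((3.26)), and their uniqueness;
* `hd` — **the differentiation of the mass integral** ((3.27)–(3.30)): `t ↦ ∫ R_t φ_t dV_t` has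
  derivative `∫ R'₀ dV` at `0` (difference quotients, the estimates of Lemma 3.2, dominated
  convergence).

Everything else in the printed argument is proved in the tree and assembled here: the family
`ds²_t` exists near `t = 0` (`AFEnd.exists_ricciFamily`, `RicciVariationFamily.lean`) and is
asymptotically flat (`AFEnd.isAsymptoticallySchwarzschild_of_metric_eq_add_ricci`,
`RicciChartDecay.lean`); the first variation `R'₀ = -‖Ric‖²` ((3.24)–(3.25),
`hasDerivAt_scalarCurvatureFn_ricciVariation`, `RicciVariationScalarCurvature.lean`);
`∫ ‖Ric‖² < ∞` (`integrable_normSq_ricci`, `RicciVariationStepsProofs.lean`) and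
`∫ ‖Ric‖² > 0` if `Ric ≢ 0` (`integral_normSq_ricci_pos`, `RicciNormSq.lean`); and the choice of
`t₀ < 0` with `M(t₀) < 0` from `M(0) = 0 < M'(0)` (`exists_lt_zero_of_hasDerivAt_pos`,
`PositiveMassRicciVariation.lean`).

* `exists_ricciVariation_massFunctionAt_of_elliptic_steps` — for given data: the mass function
  `M` of `φ_t⁴ ds²_t` on a neighbourhood of `0` with `M(0) = 0`, `M'(0)` exists, `M'(0) ≥ 0`,
  and `M'(0) > 0` if `Ric ≢ 0` ((3.26)–(3.30)), from `hc` and `hd`;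
* `exists_ricciVariation_negativeMass_of_massZero_of_elliptic_steps` — the named fact (step 2 in
  the shape of Cor. 3.1) from `hc` and `hd`;
* `ricciFlat_of_scalarFlat_of_massZero_of_elliptic_steps` — hence `Ric ≡ 0` from Thm. 1, `hc`
  and `hd` ("in contradiction to Theorem 1. Hence we conclude that `Ric ≡ 0`", p. 74); with
  `positive_mass_rigidity_of_source_facts''''` this gives `positive_mass_rigidity` from Thm. 1,
  Cor. 3.1, `hc`, `hd` and Greene–Wu's Thm. A.

All results proved; no named fact is introduced. (History: an intermediate packaging of the mass
function (3.26)–(3.30) as a separate named fact was merged back into this reduction under the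
decomposition discipline D-0026 — it was the parent fact minus the calculus lemma, not a distinct
published result; its content is the theorem `exists_ricciVariation_massFunctionAt_of_elliptic_steps`
below.)

## References

* R. Schoen, S.-T. Yau, *On the proof of the positive mass conjecture in general relativity*,
  Comm. Math. Phys. 65 (1979) 45–76: Thm. 2 (p. 48); §3, Lemmas 3.1–3.3 (pp. 63–72), the family
  `ds²_t` (p. 72), (3.24)–(3.30) and the last paragraph of the proof of Thm. 2 (pp. 73–74).
-/

noncomputable section

open Bundle Set Function Filter TopologicalSpace Manifold MeasureTheory
open scoped Manifold ContDiff Topology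

namespace Literature.Geometry.Lorentzian

/-- **The mass function of the Ricci variation, (3.26)–(3.30), from the two elliptic steps**
(Schoen–Yau, Comm. Math. Phys. 65 (1979), §3, pp. 72–74). For data `D = (h, k)` on an oriented
`3`-manifold `X` with one strongly asymptotically flat end `e` of mass parameter `0`
(`h − δ = o₅(r⁻²)`, (1.1)–(1.2) with `M = 0`) and `R(h) ≡ 0`, granted `hc` (Lemma 3.3 applied to
`ds²_t = ds² + t Ric`: positive `φ_t` with `φ_t⁴ ds²_t` scalar flat and asymptotically flat of
mass `-c₁ ∫ R_t φ_t dV_t`, `c₁ > 0`, unique) and `hd` ((3.27)–(3.30): the mass integral has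
derivative `∫ R'₀ dV` at `0`): there are `τ > 0`, the mass function `M : ℝ → ℝ` (relevant on
`(-τ, τ)`) and `M'` with (i) for `|t| < τ` a positive `φ = φ_t` and data `D'` with metric
`φ⁴ (h + t Ric(h))` pointwise, asymptotically Schwarzschildean on `e` of mass `M(t)` and scalar
flat; (ii) `M(0) = 0` (`R₀ = R ≡ 0`); (iii) `HasDerivAt M M' 0`; (iv) `M' = c₁ ∫ ‖Ric‖² dV ≥ 0`,
`> 0` if `Ric ≢ 0` ((3.25), (3.30)). The family is `AFEnd.exists_ricciFamily`, its flatness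
`AFEnd.isAsymptoticallySchwarzschild_of_metric_eq_add_ricci`, `R'₀ = -‖Ric‖²` is
`hasDerivAt_scalarCurvatureFn_ricciVariation`, and `0 < ∫ ‖Ric‖² < ∞` is
`integrable_normSq_ricci`, `integral_normSq_ricci_pos`.
[cite: SchoenYauPMT1979, §3 (3.26)–(3.30), pp. 72–74, with Lemma 3.3] -/
theorem exists_ricciVariation_massFunctionAt_of_elliptic_steps
    (hc :
      ∃ c₁ : ℝ, 0 < c₁ ∧
      ∀ (X : Type) [TopologicalSpace X] [ChartedSpace E3 X] [IsManifold (𝓡 3) ∞ X] [T2Space X]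
        [SecondCountableTopology X] [LocallyCompactSpace X] [ConnectedSpace X]
        [MeasurableSpace X] [BorelSpace X]
        (D : InitialDataSet (𝓡 3) X) [D.metric.HasLeviCivita] (e : AFEnd X) (τ : ℝ)
        (Dt : ℝ → InitialDataSet (𝓡 3) X),
        Literature.Topology.FourManifolds.IsOrientable (𝓡 3) X →
        e.IsStronglyAsymptoticallyFlatWith D 0 2 0 5 0 → e.IsSoleEnd →
        (∀ x : X, D.metric.scalarCurvature x = 0) → 0 < τ →
        (∀ t : ℝ, |t| < τ → ∀ (x : X) (v w : TangentSpace (𝓡 3) x),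
          (Dt t).metric.val x v w = D.metric.val x v w + t * D.metric.ricci x v w) →
        ∃ (τ' : ℝ) (φ : ℝ → X → ℝ) (D' : ℝ → InitialDataSet (𝓡 3) X), 0 < τ' ∧ τ' ≤ τ ∧
          ∀ t : ℝ, |t| < τ' →
            (∀ x : X, 0 < φ t x) ∧
            (∀ (x : X) (v w : TangentSpace (𝓡 3) x),
              (D' t).metric.val x v w = φ t x ^ 4 * (Dt t).metric.val x v w) ∧
            (∀ x : X, (D' t).scalarCurvatureFn x = 0) ∧
            Integrable (fun x ↦ (Dt t).scalarCurvatureFn x * φ t x) (riemannianMeasure (Dt t).h) ∧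
            IsAsymptoticallySchwarzschild e (D' t)
              (-c₁ * ∫ x, (Dt t).scalarCurvatureFn x * φ t x ∂(riemannianMeasure (Dt t).h)) 2 ∧
            (∀ (ψ : X → ℝ) (D'' : InitialDataSet (𝓡 3) X) (m : ℝ),
              (∀ x : X, 0 < ψ x) →
              (∀ (x : X) (v w : TangentSpace (𝓡 3) x),
                D''.metric.val x v w = ψ x ^ 4 * (Dt t).metric.val x v w) →
              (∀ x : X, D''.scalarCurvatureFn x = 0) →
              IsAsymptoticallySchwarzschild e D'' m 2 → ψ = φ t))
    (hd :
      ∀ (X : Type) [TopologicalSpace X] [ChartedSpace E3 X] [IsManifold (𝓡 3) ∞ X] [T2Space X]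
        [SecondCountableTopology X] [LocallyCompactSpace X] [ConnectedSpace X]
        [MeasurableSpace X] [BorelSpace X]
        (D : InitialDataSet (𝓡 3) X) [D.metric.HasLeviCivita] (e : AFEnd X) (τ : ℝ)
        (Dt : ℝ → InitialDataSet (𝓡 3) X) (R' : X → ℝ) (φ : ℝ → X → ℝ)
        (D' : ℝ → InitialDataSet (𝓡 3) X) (m : ℝ → ℝ),
        Literature.Topology.FourManifolds.IsOrientable (𝓡 3) X →
        e.IsStronglyAsymptoticallyFlatWith D 0 2 0 5 0 → e.IsSoleEnd →
        (∀ x : X, D.metric.scalarCurvature x = 0) → 0 < τ →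
        (∀ t : ℝ, |t| < τ → ∀ (x : X) (v w : TangentSpace (𝓡 3) x),
          (Dt t).metric.val x v w = D.metric.val x v w + t * D.metric.ricci x v w) →
        (∀ x : X, HasDerivAt (fun t ↦ (Dt t).scalarCurvatureFn x) (R' x) 0) →
        (∀ t : ℝ, |t| < τ →
          (∀ x : X, 0 < φ t x) ∧
          (∀ (x : X) (v w : TangentSpace (𝓡 3) x),
            (D' t).metric.val x v w = φ t x ^ 4 * (Dt t).metric.val x v w) ∧
          (∀ x : X, (D' t).scalarCurvatureFn x = 0) ∧
          IsAsymptoticallySchwarzschild e (D' t) (m t) 2) →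
        HasDerivAt (fun t ↦ ∫ x, (Dt t).scalarCurvatureFn x * φ t x ∂(riemannianMeasure (Dt t).h))
          (∫ x, R' x ∂(riemannianMeasure D.h)) 0)
    (X : Type) [TopologicalSpace X] [ChartedSpace E3 X] [IsManifold (𝓡 3) ∞ X] [T2Space X]
    [SecondCountableTopology X] [ConnectedSpace X]
    (D : InitialDataSet (𝓡 3) X) [D.metric.HasLeviCivita] (e : AFEnd X)
    (hor : Literature.Topology.FourManifolds.IsOrientable (𝓡 3) X)
    (haf : e.IsStronglyAsymptoticallyFlatWith D 0 2 0 5 0) (hsole : e.IsSoleEnd)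
    (hR0 : ∀ x : X, D.metric.scalarCurvature x = 0) :
    ∃ (τ : ℝ) (M : ℝ → ℝ) (M' : ℝ), 0 < τ ∧
      (∀ t : ℝ, |t| < τ →
        ∃ (φ : X → ℝ) (D' : InitialDataSet (𝓡 3) X) (_ : D'.metric.HasLeviCivita),
          (∀ x : X, 0 < φ x) ∧
          (∀ (x : X) (v w : TangentSpace (𝓡 3) x),
            D'.metric.val x v w =
              φ x ^ 4 * (D.metric.val x v w + t * D.metric.ricci x v w)) ∧
          IsAsymptoticallySchwarzschild e D' (M t) 2 ∧
          ∀ x : X, D'.metric.scalarCurvature x = 0) ∧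
      M 0 = 0 ∧ HasDerivAt M M' 0 ∧ 0 ≤ M' ∧ ((∃ x : X, D.metric.ricci x ≠ 0) → 0 < M') := by
  letI : MeasurableSpace X := borel X
  haveI : BorelSpace X := ⟨rfl⟩
  haveI : LocallyCompactSpace X := ChartedSpace.locallyCompactSpace E3 X
  obtain ⟨c₁, hc₁, hc⟩ := hc
  -- p. 72: the family `ds²_t = ds² + t Ric` near `t = 0`
  obtain ⟨τ, Dt, hτ, hDt⟩ := e.exists_ricciFamily D haf hsole
  have hval : ∀ t : ℝ, |t| < τ → ∀ (x : X) (v w : TangentSpace (𝓡 3) x),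
      (Dt t).metric.val x v w = D.metric.val x v w + t * D.metric.ricci x v w :=
    fun t ht ↦ (hDt t ht).1
  -- Lemma 3.3 applied to the family: `φ_t`, `D'_t = φ_t⁴ ds²_t`, the mass formula (3.26)
  obtain ⟨τ', φ, D', hτ', hτ'τ, hfam⟩ := hc X D e τ Dt hor haf hsole hR0 hτ hval
  have hval' : ∀ t : ℝ, |t| < τ' → ∀ (x : X) (v w : TangentSpace (𝓡 3) x),
      (Dt t).metric.val x v w = D.metric.val x v w + t * D.metric.ricci x v w :=
    fun t ht ↦ hval t (ht.trans_le hτ'τ)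
  -- the mass integral `I(t) = ∫ R_t φ_t dV_t` and the mass function `M(t) = -c₁ I(t)`
  set μ : Measure X := riemannianMeasure D.h with hμ
  set I : ℝ → ℝ := fun t ↦
    ∫ x, (Dt t).scalarCurvatureFn x * φ t x ∂(riemannianMeasure (Dt t).h) with hI
  set M : ℝ → ℝ := fun t ↦ -c₁ * I t with hM
  set S : ℝ := ∫ x, D.metric.normSq x (D.metric.ricci x) ∂μ with hS
  -- (3.24)–(3.25): `R'₀ = -‖Ric‖²`; (3.27)–(3.30): `I'(0) = ∫ R'₀ dV = -∫ ‖Ric‖² dV`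
  have hR' : ∀ x : X, HasDerivAt (fun t ↦ (Dt t).scalarCurvatureFn x)
      (-(D.metric.normSq x (D.metric.ricci x))) 0 :=
    hasDerivAt_scalarCurvatureFn_ricciVariation D hτ Dt hR0 hval
  have hId : HasDerivAt I (∫ x, -(D.metric.normSq x (D.metric.ricci x)) ∂μ) 0 :=
    hd X D e τ' Dt (fun x ↦ -(D.metric.normSq x (D.metric.ricci x))) φ D' M hor haf hsole hR0
      hτ' hval' hR' fun t ht ↦
      ⟨(hfam t ht).1, (hfam t ht).2.1, (hfam t ht).2.2.1, (hfam t ht).2.2.2.2.1⟩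
  have hId' : HasDerivAt I (-S) 0 := by
    have h := hId
    rw [integral_neg] at h
    exact h
  have hMd : HasDerivAt M (c₁ * S) 0 := by
    have h := hId'.const_mul (-c₁)
    rwa [show -c₁ * -S = c₁ * S by ring] at h
  -- `M(0) = 0` since `R₀ = R ≡ 0`
  have hR0fn : (Dt 0).scalarCurvatureFn = fun _ ↦ 0 := by
    have h0 : (Dt 0).scalarCurvatureFn = D.scalarCurvatureFn :=
      InitialDataSet.scalarCurvatureFn_congr fun x v w ↦ by rw [hval 0 (by simpa using hτ)]; ring
    rw [h0]
    funext x
    rw [InitialDataSet.scalarCurvatureFn_eq]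
    exact hR0 x
  have hM0 : M 0 = 0 := by
    simp only [hM, hI, hR0fn, zero_mul, integral_zero, mul_zero]
  -- `∫ ‖Ric‖² ≥ 0`, finite, and `> 0` if `Ric ≢ 0`
  have hS0 : 0 ≤ S := integral_nonneg fun x ↦
    D.metric.normSq_nonneg x D.isRiemannian_metric (D.metric.ricci x)
  have hint : Integrable (fun x ↦ D.metric.normSq x (D.metric.ricci x)) μ :=
    integrable_normSq_ricci D e haf hsole
  refine ⟨τ', M, c₁ * S, hτ', fun t ht ↦ ?_, hM0, hMd, mul_nonneg hc₁.le hS0, fun hRic ↦ ?_⟩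
  · obtain ⟨hφ, hconf, hRt, -, hAS, -⟩ := hfam t ht
    refine ⟨φ t, D' t, (D' t).metric.hasLeviCivita, hφ, fun x v w ↦ ?_, hAS, fun x ↦ ?_⟩
    · rw [hconf, hval' t ht]
    · rw [← InitialDataSet.scalarCurvatureFn_eq]
      exact hRt x
  · exact mul_pos hc₁ (integral_normSq_ricci_pos D hint hRic)

/-- **Step 2 of positive mass rigidity from the two elliptic steps** (Schoen–Yau 1979, §3,
p. 74, exactly as printed): granted `hc` (Lemma 3.3 applied to `ds²_t = ds² + t Ric`, with the
mass formula (3.26) and uniqueness) and `hd` ((3.27)–(3.30)), the mass function of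
`exists_ricciVariation_massFunctionAt_of_elliptic_steps` has `M(0) = 0` and `M'(0) > 0` when
`Ric ≢ 0`, so *"by choosing a suitable `t₀ < 0` we would have `M(t₀) < 0`. The metric
`φ_{t₀}⁴ ds²_{t₀}` would then be asymptotically flat, scalar flat, and `N_k` would have negative
total mass"* — the named fact `exists_ricciVariation_negativeMass_of_massZero` of
`PositiveMassRigidity.lean`; the choice of `t₀` is `exists_lt_zero_of_hasDerivAt_pos`.
[cite: SchoenYauPMT1979, §3 (3.26)–(3.30), pp. 72–74, with Lemma 3.3] -/
theorem exists_ricciVariation_negativeMass_of_massZero_of_elliptic_steps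
    (hc :
      ∃ c₁ : ℝ, 0 < c₁ ∧
      ∀ (X : Type) [TopologicalSpace X] [ChartedSpace E3 X] [IsManifold (𝓡 3) ∞ X] [T2Space X]
        [SecondCountableTopology X] [LocallyCompactSpace X] [ConnectedSpace X]
        [MeasurableSpace X] [BorelSpace X]
        (D : InitialDataSet (𝓡 3) X) [D.metric.HasLeviCivita] (e : AFEnd X) (τ : ℝ)
        (Dt : ℝ → InitialDataSet (𝓡 3) X),
        Literature.Topology.FourManifolds.IsOrientable (𝓡 3) X →
        e.IsStronglyAsymptoticallyFlatWith D 0 2 0 5 0 → e.IsSoleEnd →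
        (∀ x : X, D.metric.scalarCurvature x = 0) → 0 < τ →
        (∀ t : ℝ, |t| < τ → ∀ (x : X) (v w : TangentSpace (𝓡 3) x),
          (Dt t).metric.val x v w = D.metric.val x v w + t * D.metric.ricci x v w) →
        ∃ (τ' : ℝ) (φ : ℝ → X → ℝ) (D' : ℝ → InitialDataSet (𝓡 3) X), 0 < τ' ∧ τ' ≤ τ ∧
          ∀ t : ℝ, |t| < τ' →
            (∀ x : X, 0 < φ t x) ∧
            (∀ (x : X) (v w : TangentSpace (𝓡 3) x),
              (D' t).metric.val x v w = φ t x ^ 4 * (Dt t).metric.val x v w) ∧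
            (∀ x : X, (D' t).scalarCurvatureFn x = 0) ∧
            Integrable (fun x ↦ (Dt t).scalarCurvatureFn x * φ t x) (riemannianMeasure (Dt t).h) ∧
            IsAsymptoticallySchwarzschild e (D' t)
              (-c₁ * ∫ x, (Dt t).scalarCurvatureFn x * φ t x ∂(riemannianMeasure (Dt t).h)) 2 ∧
            (∀ (ψ : X → ℝ) (D'' : InitialDataSet (𝓡 3) X) (m : ℝ),
              (∀ x : X, 0 < ψ x) →
              (∀ (x : X) (v w : TangentSpace (𝓡 3) x),
                D''.metric.val x v w = ψ x ^ 4 * (Dt t).metric.val x v w) →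
              (∀ x : X, D''.scalarCurvatureFn x = 0) →
              IsAsymptoticallySchwarzschild e D'' m 2 → ψ = φ t))
    (hd :
      ∀ (X : Type) [TopologicalSpace X] [ChartedSpace E3 X] [IsManifold (𝓡 3) ∞ X] [T2Space X]
        [SecondCountableTopology X] [LocallyCompactSpace X] [ConnectedSpace X]
        [MeasurableSpace X] [BorelSpace X]
        (D : InitialDataSet (𝓡 3) X) [D.metric.HasLeviCivita] (e : AFEnd X) (τ : ℝ)
        (Dt : ℝ → InitialDataSet (𝓡 3) X) (R' : X → ℝ) (φ : ℝ → X → ℝ)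
        (D' : ℝ → InitialDataSet (𝓡 3) X) (m : ℝ → ℝ),
        Literature.Topology.FourManifolds.IsOrientable (𝓡 3) X →
        e.IsStronglyAsymptoticallyFlatWith D 0 2 0 5 0 → e.IsSoleEnd →
        (∀ x : X, D.metric.scalarCurvature x = 0) → 0 < τ →
        (∀ t : ℝ, |t| < τ → ∀ (x : X) (v w : TangentSpace (𝓡 3) x),
          (Dt t).metric.val x v w = D.metric.val x v w + t * D.metric.ricci x v w) →
        (∀ x : X, HasDerivAt (fun t ↦ (Dt t).scalarCurvatureFn x) (R' x) 0) →
        (∀ t : ℝ, |t| < τ →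
          (∀ x : X, 0 < φ t x) ∧
          (∀ (x : X) (v w : TangentSpace (𝓡 3) x),
            (D' t).metric.val x v w = φ t x ^ 4 * (Dt t).metric.val x v w) ∧
          (∀ x : X, (D' t).scalarCurvatureFn x = 0) ∧
          IsAsymptoticallySchwarzschild e (D' t) (m t) 2) →
        HasDerivAt (fun t ↦ ∫ x, (Dt t).scalarCurvatureFn x * φ t x ∂(riemannianMeasure (Dt t).h))
          (∫ x, R' x ∂(riemannianMeasure D.h)) 0) :
    exists_ricciVariation_negativeMass_of_massZero := by
  intro X _ _ _ _ _ _ D _ e hor haf hsole hR0 hRic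
  obtain ⟨τ, M, M', hτ, hfam, hM0, hderiv, -, hpos⟩ :=
    exists_ricciVariation_massFunctionAt_of_elliptic_steps hc hd X D e hor haf hsole hR0
  obtain ⟨t₀, ht₀τ, ht₀0, hMt₀⟩ := exists_lt_zero_of_hasDerivAt_pos hderiv hM0 (hpos hRic) hτ
  obtain ⟨φ, D', hL, hφ, hval, hAS, hR'⟩ := hfam t₀ (abs_lt.2 ⟨ht₀τ, ht₀0.trans hτ⟩)
  exact ⟨t₀, φ, D', hL, M t₀, ht₀0, hφ, hval, hAS, hMt₀, hR'⟩

/-- **`Ric ≡ 0` from Thm. 1 and the two elliptic steps** (Schoen–Yau 1979, p. 74: the metric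
`φ_{t₀}⁴ ds²_{t₀}` of negative mass is "in contradiction to Theorem 1. Hence we conclude that
`Ric ≡ 0`"): step 2 of positive mass rigidity, `ricciFlat_of_scalarFlat_of_massZero`, from the
positive mass theorem in Schoen–Yau's form (`schoenYau_mass_nonneg`, Thm. 1), Lemma 3.3 on the
family (`hc`) and the differentiation of the mass integral (`hd`), via
`ricciFlat_of_scalarFlat_of_massZero_of_facts`. With `positive_mass_rigidity_of_source_facts''''`
(`AsymptoticallyFlatCompleteness.lean`) the same two steps, Thm. 1, Cor. 3.1 and Greene–Wu's
Thm. A give `positive_mass_rigidity`. [cite: SchoenYauPMT1979, §3 p. 74] -/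
theorem ricciFlat_of_scalarFlat_of_massZero_of_elliptic_steps (h₀ : schoenYau_mass_nonneg)
    (hc :
      ∃ c₁ : ℝ, 0 < c₁ ∧
      ∀ (X : Type) [TopologicalSpace X] [ChartedSpace E3 X] [IsManifold (𝓡 3) ∞ X] [T2Space X]
        [SecondCountableTopology X] [LocallyCompactSpace X] [ConnectedSpace X]
        [MeasurableSpace X] [BorelSpace X]
        (D : InitialDataSet (𝓡 3) X) [D.metric.HasLeviCivita] (e : AFEnd X) (τ : ℝ)
        (Dt : ℝ → InitialDataSet (𝓡 3) X),
        Literature.Topology.FourManifolds.IsOrientable (𝓡 3) X →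
        e.IsStronglyAsymptoticallyFlatWith D 0 2 0 5 0 → e.IsSoleEnd →
        (∀ x : X, D.metric.scalarCurvature x = 0) → 0 < τ →
        (∀ t : ℝ, |t| < τ → ∀ (x : X) (v w : TangentSpace (𝓡 3) x),
          (Dt t).metric.val x v w = D.metric.val x v w + t * D.metric.ricci x v w) →
        ∃ (τ' : ℝ) (φ : ℝ → X → ℝ) (D' : ℝ → InitialDataSet (𝓡 3) X), 0 < τ' ∧ τ' ≤ τ ∧
          ∀ t : ℝ, |t| < τ' →
            (∀ x : X, 0 < φ t x) ∧
            (∀ (x : X) (v w : TangentSpace (𝓡 3) x),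
              (D' t).metric.val x v w = φ t x ^ 4 * (Dt t).metric.val x v w) ∧
            (∀ x : X, (D' t).scalarCurvatureFn x = 0) ∧
            Integrable (fun x ↦ (Dt t).scalarCurvatureFn x * φ t x) (riemannianMeasure (Dt t).h) ∧
            IsAsymptoticallySchwarzschild e (D' t)
              (-c₁ * ∫ x, (Dt t).scalarCurvatureFn x * φ t x ∂(riemannianMeasure (Dt t).h)) 2 ∧
            (∀ (ψ : X → ℝ) (D'' : InitialDataSet (𝓡 3) X) (m : ℝ),
              (∀ x : X, 0 < ψ x) →
              (∀ (x : X) (v w : TangentSpace (𝓡 3) x),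
                D''.metric.val x v w = ψ x ^ 4 * (Dt t).metric.val x v w) →
              (∀ x : X, D''.scalarCurvatureFn x = 0) →
              IsAsymptoticallySchwarzschild e D'' m 2 → ψ = φ t))
    (hd :
      ∀ (X : Type) [TopologicalSpace X] [ChartedSpace E3 X] [IsManifold (𝓡 3) ∞ X] [T2Space X]
        [SecondCountableTopology X] [LocallyCompactSpace X] [ConnectedSpace X]
        [MeasurableSpace X] [BorelSpace X]
        (D : InitialDataSet (𝓡 3) X) [D.metric.HasLeviCivita] (e : AFEnd X) (τ : ℝ)
        (Dt : ℝ → InitialDataSet (𝓡 3) X) (R' : X → ℝ) (φ : ℝ → X → ℝ)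
        (D' : ℝ → InitialDataSet (𝓡 3) X) (m : ℝ → ℝ),
        Literature.Topology.FourManifolds.IsOrientable (𝓡 3) X →
        e.IsStronglyAsymptoticallyFlatWith D 0 2 0 5 0 → e.IsSoleEnd →
        (∀ x : X, D.metric.scalarCurvature x = 0) → 0 < τ →
        (∀ t : ℝ, |t| < τ → ∀ (x : X) (v w : TangentSpace (𝓡 3) x),
          (Dt t).metric.val x v w = D.metric.val x v w + t * D.metric.ricci x v w) →
        (∀ x : X, HasDerivAt (fun t ↦ (Dt t).scalarCurvatureFn x) (R' x) 0) →
        (∀ t : ℝ, |t| < τ →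
          (∀ x : X, 0 < φ t x) ∧
          (∀ (x : X) (v w : TangentSpace (𝓡 3) x),
            (D' t).metric.val x v w = φ t x ^ 4 * (Dt t).metric.val x v w) ∧
          (∀ x : X, (D' t).scalarCurvatureFn x = 0) ∧
          IsAsymptoticallySchwarzschild e (D' t) (m t) 2) →
        HasDerivAt (fun t ↦ ∫ x, (Dt t).scalarCurvatureFn x * φ t x ∂(riemannianMeasure (Dt t).h))
          (∫ x, R' x ∂(riemannianMeasure D.h)) 0) :
    ricciFlat_of_scalarFlat_of_massZero :=
  ricciFlat_of_scalarFlat_of_massZero_of_facts h₀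
    (exists_ricciVariation_negativeMass_of_massZero_of_elliptic_steps hc hd)

end Literature.Geometry.Lorentzian

end
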